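import Mathlib

/-!
# EriceRemainderEnclosureHistoryAutonomyComparisonAgeCompositionTripleBox — (E103b) route (N), first order: ONE BOX OF THE OLD-TRIPLE CAP (pure).
# The three pin-window letters of an old triple (E103a) are a 3 × 3 linear programme in the loads `(x, z, y)`; LP duality certifies `x + z + y ≤ V`
# by three MULTIPLIERS `λ₁, λ₂, λ₃ ≥ 0` with `λ₁ + λ₂ + λ₃ ≤ V` covering every column (**`triple_cap_of_multipliers`**).  On a box of the four shape
# parameters (`k∕j ∈ [F₁l, F₁h]`, `n∕k ∈ [F₂l, F₂h]`, `σ₁ ∈ [s₁l, s₁h]`, `σ₂ ∈ [s₂l, s₂h]`) every coefficient is monotone in each parameter, so it is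
# bounded below by its value at one corner: the split K coefficients at the top `σ` and bottom span (**`splitK_ge`**, the corner step of (E102a)
# `old_pair_box_two`), the older-age coefficients `2c(u∕w)σ²` at the bottom `σ` and top span (**`oldJ_ge`**); **`old_triple_box`** assembles the box
# leaf: letters + box + split data + corner values + multipliers ⟹ `x + z + y ≤ V`.  Numerics (`HOME/b2b-balaban-beta-d4-p2/g89/numerics/cert_triple.py`):
# an adaptive 4-dimensional partition certifies the old triple at `V = 0.67 ∕ 0.68` on `(k∕j, n∕k) ∈ (2,3]²` with 170 ∕ 111 boxes, `0.715` on `(3,4]²`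
# with 52, `0.75` on `(2,3] × (4,8]` with 79, `0.79` on `(4,8]²` with 191 (LP values `0.648 ∕ 0.675 ∕ 0.698 ∕ 0.748`; the argmax block caps are
# `0.77 ∕ 0.89 ∕ — ∕ 1.05+`).

Cell `pub-balaban`, β-function sub-cell, BINDER row D4 «RemainderConst leaves for Bałaban's split» (`HOME/BINDER-OWNERS.md`; owner lineage `b2b-balaban-beta-an4`;
this file by co-owner #2 lineage `b2b-balaban-beta-d4-p2`, generation 89), β-FLOW TEAM duty (1), FREEZE (0) honoured (def-free; Mathlib only; nothing restated).

HONEST FRAMING (page 1, verbatim and binding).  *"Discharging BetaPertH makes Bałaban's UV stability UNCONDITIONAL — a real constructive-QFT result; it is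
NOT the continuum limit and NOT the Clay problem."*  THIS FILE DISCHARGES NOTHING OF THE KIND.  Elementary real algebra about real numbers satisfying three
linear inequalities — hypotheses of a census, not facts; the form, signs, ages and moments of Bałaban's (1.22) limit functional are NOT PRINTED ([I] p. 298;
GAPS G-t4-U2-1∕-2) and NOT asserted.  Row D4 class UNCHANGED (critical-path width 0; instance 0∕1; D4 DISCHARGE NO DATE).  HONEST DEPENDENCY: continuum YM
on T⁴ ⇐ BetaPertH ∧ nine spine estimates (0/9 proved); BetaPertH ⇐ (D1) ∧ (D4) ∧ CAP+tail; G-an2-4 gates asym, D1 and NE2/3/4.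

THE POINT (README `HOME/b2b-balaban-beta-d4-p2/g89/README.md` §3).  NOT CLAIMED: anything about flows (sequels); the table (sequels); anything printed — NOT B12
Thm 2, NOT BetaPertH, NOT continuum, NOT Clay.

WHAT IS PROVED ([folklore]; 0 `def`, 0 sorry).  §1 **`triple_cap_of_multipliers`**.  §2 **`splitK_ge`**, **`oldJ_ge`**, **`old_triple_box`**.
-/
noncomputable section

namespace Summit.QuantumFields.BalabanUV.Beta.EriceRemainderEnclosureHistoryAutonomyComparisonAgeCompositionTripleBox

/-! ## §1 Three letters, three multipliers -/

/-- **THE TRIPLE CAP BY MULTIPLIERS (pure LP duality).**  Loads `x, z, y ≥ 0` with three letters `aᵢ·x + bᵢ·z + dᵢ·y ≤ 1` (`i = 1,2,3`), lower bounds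
`Aᵢ ≤ aᵢ`, `Bᵢ ≤ bᵢ`, `Dᵢ ≤ dᵢ`, multipliers `λᵢ ≥ 0` covering every column (`Σᵢ λᵢAᵢ ≥ 1`, `Σᵢ λᵢBᵢ ≥ 1`, `Σᵢ λᵢDᵢ ≥ 1`) with `λ₁ + λ₂ + λ₃ ≤ V`.
THEN `x + z + y ≤ V`. [folklore] -/
theorem triple_cap_of_multipliers {x z y a₁ b₁ d₁ a₂ b₂ d₂ a₃ b₃ d₃ A₁ B₁ D₁ A₂ B₂ D₂ A₃ B₃ D₃ l₁ l₂ l₃ V : ℝ}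
    (hx : 0 ≤ x) (hz : 0 ≤ z) (hy : 0 ≤ y)
    (h₁ : a₁ * x + b₁ * z + d₁ * y ≤ 1) (h₂ : a₂ * x + b₂ * z + d₂ * y ≤ 1) (h₃ : a₃ * x + b₃ * z + d₃ * y ≤ 1)
    (hA₁ : A₁ ≤ a₁) (hB₁ : B₁ ≤ b₁) (hD₁ : D₁ ≤ d₁) (hA₂ : A₂ ≤ a₂) (hB₂ : B₂ ≤ b₂) (hD₂ : D₂ ≤ d₂)
    (hA₃ : A₃ ≤ a₃) (hB₃ : B₃ ≤ b₃) (hD₃ : D₃ ≤ d₃) (hl₁ : 0 ≤ l₁) (hl₂ : 0 ≤ l₂) (hl₃ : 0 ≤ l₃)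
    (hcx : 1 ≤ l₁ * A₁ + l₂ * A₂ + l₃ * A₃) (hcz : 1 ≤ l₁ * B₁ + l₂ * B₂ + l₃ * B₃) (hcy : 1 ≤ l₁ * D₁ + l₂ * D₂ + l₃ * D₃)
    (hV : l₁ + l₂ + l₃ ≤ V) : x + z + y ≤ V := by
  have cx : 1 ≤ l₁ * a₁ + l₂ * a₂ + l₃ * a₃ := by
    nlinarith [mul_le_mul_of_nonneg_left hA₁ hl₁, mul_le_mul_of_nonneg_left hA₂ hl₂, mul_le_mul_of_nonneg_left hA₃ hl₃]
  have cz : 1 ≤ l₁ * b₁ + l₂ * b₂ + l₃ * b₃ := by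
    nlinarith [mul_le_mul_of_nonneg_left hB₁ hl₁, mul_le_mul_of_nonneg_left hB₂ hl₂, mul_le_mul_of_nonneg_left hB₃ hl₃]
  have cy : 1 ≤ l₁ * d₁ + l₂ * d₂ + l₃ * d₃ := by
    nlinarith [mul_le_mul_of_nonneg_left hD₁ hl₁, mul_le_mul_of_nonneg_left hD₂ hl₂, mul_le_mul_of_nonneg_left hD₃ hl₃]
  have ex := mul_le_mul_of_nonneg_left cx hx
  have ez := mul_le_mul_of_nonneg_left cz hz
  have ey := mul_le_mul_of_nonneg_left cy hy
  have e₁ := mul_le_mul_of_nonneg_left h₁ hl₁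
  have e₂ := mul_le_mul_of_nonneg_left h₂ hl₂
  have e₃ := mul_le_mul_of_nonneg_left h₃ hl₃
  have key : x + z + y ≤ l₁ * (a₁ * x + b₁ * z + d₁ * y) + l₂ * (a₂ * x + b₂ * z + d₂ * y) + l₃ * (a₃ * x + b₃ * z + d₃ * y) := by
    have eq : x * (l₁ * a₁ + l₂ * a₂ + l₃ * a₃) + z * (l₁ * b₁ + l₂ * b₂ + l₃ * b₃) + y * (l₁ * d₁ + l₂ * d₂ + l₃ * d₃)
        = l₁ * (a₁ * x + b₁ * z + d₁ * y) + l₂ * (a₂ * x + b₂ * z + d₂ * y) + l₃ * (a₃ * x + b₃ * z + d₃ * y) := by ring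
    linarith [ex, ez, ey, eq]
  linarith [key, e₁, e₂, e₃]

/-! ## §2 The corner values and the box leaf -/

/-- **THE SPLIT K COEFFICIENT AT ITS WORST CORNER.**  A younger age `u > 0` read in the window of an older age `w` (`Fl·u ≤ w`), split length `τ` with
`θlo·u ≤ τ ≤ θ·u` (`θlo ≥ 0`, `θ + 1 ≤ Fl`), level ratio `0 < σ ≤ sh`, constants `c_T, c_b ≥ 0`:
`2c_Tθlo∕sh² + 2(Fl − 1 − θ + c_b)∕sh³ ≤ 2c_T(τ∕u)∕σ² + 2((w − u − τ)∕u + c_b)∕σ³`. [folklore] -/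
theorem splitK_ge {u w τ σ sh θlo θ Fl cT cb : ℝ} (hu : 0 < u) (hw : Fl * u ≤ w) (hτlo : θlo * u ≤ τ) (hτhi : τ ≤ θ * u) (hθlo : 0 ≤ θlo)
    (hθ : θ + 1 ≤ Fl) (hσ : 0 < σ) (hσh : σ ≤ sh) (hcT : 0 ≤ cT) (hcb : 0 ≤ cb) :
    2 * cT * θlo / sh ^ 2 + 2 * (Fl - 1 - θ + cb) / sh ^ 3 ≤ 2 * cT * (τ / u) / σ ^ 2 + 2 * ((w - u - τ) / u + cb) / σ ^ 3 := by
  have ht1 : θlo ≤ τ / u := by rw [le_div_iff₀ hu]; exact hτlo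
  have ht2 : Fl - 1 - θ ≤ (w - u - τ) / u := by rw [le_div_iff₀ hu]; nlinarith
  have hθ0 : 0 ≤ θ := by have : 0 ≤ θ * u := le_trans (le_trans (mul_nonneg hθlo hu.le) hτlo) hτhi; nlinarith
  have hτ0 : 0 ≤ τ := le_trans (mul_nonneg hθlo hu.le) hτlo
  have hsh : 0 < sh := lt_of_lt_of_le hσ hσh
  have s2 : 1 / sh ^ 2 ≤ 1 / σ ^ 2 := one_div_le_one_div_of_le (pow_pos hσ 2) (pow_le_pow_left₀ hσ.le hσh 2)
  have s3 : 1 / sh ^ 3 ≤ 1 / σ ^ 3 := one_div_le_one_div_of_le (pow_pos hσ 3) (pow_le_pow_left₀ hσ.le hσh 3)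
  have a1 : 2 * cT * θlo / sh ^ 2 ≤ 2 * cT * (τ / u) / σ ^ 2 := by
    calc 2 * cT * θlo / sh ^ 2 = 2 * cT * θlo * (1 / sh ^ 2) := by ring
      _ ≤ 2 * cT * (τ / u) * (1 / σ ^ 2) :=
          mul_le_mul (mul_le_mul_of_nonneg_left ht1 (by positivity)) s2 (by positivity) (mul_nonneg (by positivity) (div_nonneg hτ0 hu.le))
      _ = 2 * cT * (τ / u) / σ ^ 2 := by ring
  have a2 : 2 * (Fl - 1 - θ + cb) / sh ^ 3 ≤ 2 * ((w - u - τ) / u + cb) / σ ^ 3 := by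
    calc 2 * (Fl - 1 - θ + cb) / sh ^ 3 = 2 * (Fl - 1 - θ + cb) * (1 / sh ^ 3) := by ring
      _ ≤ 2 * ((w - u - τ) / u + cb) * (1 / σ ^ 3) := mul_le_mul (by linarith) s3 (by positivity) (by linarith)
      _ = 2 * ((w - u - τ) / u + cb) / σ ^ 3 := by ring
  linarith

/-- **AN OLDER AGE'S COEFFICIENT AT ITS WORST CORNER.**  A younger window `u > 0`, an older age `w ≤ Fh·u` (`w > 0`), level ratio `σ ≥ sl ≥ 0`, constant
`c ≥ 0`: `2c·sl²∕Fh ≤ 2c(u∕w)σ²`. [folklore] -/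
theorem oldJ_ge {u w σ sl Fh c : ℝ} (hu : 0 < u) (hw : 0 < w) (hwF : w ≤ Fh * u) (hsl : 0 ≤ sl) (hσ : sl ≤ σ) (hc : 0 ≤ c) :
    2 * c * sl ^ 2 / Fh ≤ 2 * c * (u / w) * σ ^ 2 := by
  have hFh : 0 < Fh := by nlinarith
  have b1 : sl ^ 2 ≤ σ ^ 2 := pow_le_pow_left₀ hsl hσ 2
  have b2 : 1 / Fh ≤ u / w := by rw [div_le_div_iff₀ hFh hw]; linarith
  calc 2 * c * sl ^ 2 / Fh = 2 * c * (1 / Fh) * sl ^ 2 := by ring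
    _ ≤ 2 * c * (u / w) * σ ^ 2 := mul_le_mul (mul_le_mul_of_nonneg_left b2 (by positivity)) b1 (by positivity) (by positivity)

/-- **ONE BOX OF THE OLD-TRIPLE CAP (pure).**  Loads `x, z, y ≥ 0` of ages `jr < kr < nr` (reals, `0 < j₀ ≤ jr`) in the span box `F₁l·jr ≤ kr ≤ F₁h·jr`,
`F₂l·kr ≤ nr ≤ F₂h·kr` (`F₁l, F₂l ≥ 1`), level ratios `σ₁ ∈ [s₁l, s₁h]`, `σ₂ ∈ [s₂l, s₂h]` (`s₁l, s₂l > 0`), split lengths `θᵢlo·(age) ≤ τᵢ ≤ θᵢ·(age)`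
(`i = 1`: `j` in the window of `k`; `2`: `j` in the window of `n`; `3`: `k` in the window of `n`), the three letters of (E103a) with constants `c₀` (own),
`c₁, c₂, c₃ ≥ 0` (older ∕ far), `c_{T₁}, c_{T₂}, c_{T₃} ≥ 0` (split rays), corner values `Jz, Jy, Kx₁, Jy₂, Kx₂, Kz` below the displayed corner expressions,
and multipliers `λ₁, λ₂, λ₃ ≥ 0` covering the three columns with `λ₁ + λ₂ + λ₃ ≤ V`.  THEN `x + z + y ≤ V` (§1 after `splitK_ge` ×3 and `oldJ_ge` ×3).
[folklore] -/
theorem old_triple_box {x z y σ₁ σ₂ jr kr nr τ₁ τ₂ τ₃ j₀ c₀ c₁ c₂ c₃ cT₁ cT₂ cT₃ θ₁lo θ₁ θ₂lo θ₂ θ₃lo θ₃ F₁l F₁h F₂l F₂h s₁l s₁h s₂l s₂h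
      Jz Jy Kx₁ Jy₂ Kx₂ Kz l₁ l₂ l₃ V : ℝ}
    (hx : 0 ≤ x) (hz : 0 ≤ z) (hy : 0 ≤ y) (hj₀ : 0 < j₀) (hjr : j₀ ≤ jr)
    (hk1 : F₁l * jr ≤ kr) (hk2 : kr ≤ F₁h * jr) (hn1 : F₂l * kr ≤ nr) (hn2 : nr ≤ F₂h * kr) (hF₁ : 1 ≤ F₁l) (hF₂ : 1 ≤ F₂l)
    (hσ₁l : s₁l ≤ σ₁) (hσ₁h : σ₁ ≤ s₁h) (hσ₂l : s₂l ≤ σ₂) (hσ₂h : σ₂ ≤ s₂h) (hs₁ : 0 < s₁l) (hs₂ : 0 < s₂l)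
    (hτ₁l : θ₁lo * jr ≤ τ₁) (hτ₁h : τ₁ ≤ θ₁ * jr) (hτ₂l : θ₂lo * jr ≤ τ₂) (hτ₂h : τ₂ ≤ θ₂ * jr) (hτ₃l : θ₃lo * kr ≤ τ₃) (hτ₃h : τ₃ ≤ θ₃ * kr)
    (hθ₁lo : 0 ≤ θ₁lo) (hθ₂lo : 0 ≤ θ₂lo) (hθ₃lo : 0 ≤ θ₃lo) (hθ₁ : θ₁ + 1 ≤ F₁l) (hθ₂ : θ₂ + 1 ≤ F₁l * F₂l) (hθ₃ : θ₃ + 1 ≤ F₂l)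
    (hc₁ : 0 ≤ c₁) (hc₂ : 0 ≤ c₂) (hc₃ : 0 ≤ c₃) (hcT₁ : 0 ≤ cT₁) (hcT₂ : 0 ≤ cT₂) (hcT₃ : 0 ≤ cT₃)
    (hWj : 2 * c₀ * x + 2 * c₁ * (jr / kr) * σ₁ ^ 2 * z + 2 * c₂ * (jr / nr) * (σ₁ * σ₂) ^ 2 * y ≤ 1)
    (hWk : (2 * cT₁ * (τ₁ / jr) / σ₁ ^ 2 + 2 * ((kr - jr - τ₁) / jr + c₁) / σ₁ ^ 3) * x + 2 * c₀ * z + 2 * c₃ * (kr / nr) * σ₂ ^ 2 * y ≤ 1)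
    (hWn : (2 * cT₂ * (τ₂ / jr) / (σ₁ * σ₂) ^ 2 + 2 * ((nr - jr - τ₂) / jr + c₂) / (σ₁ * σ₂) ^ 3) * x
      + (2 * cT₃ * (τ₃ / kr) / σ₂ ^ 2 + 2 * ((nr - kr - τ₃) / kr + c₃) / σ₂ ^ 3) * z + 2 * c₀ * y ≤ 1)
    (hJz : Jz ≤ 2 * c₁ * s₁l ^ 2 / F₁h) (hJy : Jy ≤ 2 * c₂ * (s₁l * s₂l) ^ 2 / (F₁h * F₂h))
    (hKx₁ : Kx₁ ≤ 2 * cT₁ * θ₁lo / s₁h ^ 2 + 2 * (F₁l - 1 - θ₁ + c₁) / s₁h ^ 3) (hJy₂ : Jy₂ ≤ 2 * c₃ * s₂l ^ 2 / F₂h)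
    (hKx₂ : Kx₂ ≤ 2 * cT₂ * θ₂lo / (s₁h * s₂h) ^ 2 + 2 * (F₁l * F₂l - 1 - θ₂ + c₂) / (s₁h * s₂h) ^ 3)
    (hKz : Kz ≤ 2 * cT₃ * θ₃lo / s₂h ^ 2 + 2 * (F₂l - 1 - θ₃ + c₃) / s₂h ^ 3)
    (hl₁ : 0 ≤ l₁) (hl₂ : 0 ≤ l₂) (hl₃ : 0 ≤ l₃)
    (hcx : 1 ≤ l₁ * (2 * c₀) + l₂ * Kx₁ + l₃ * Kx₂) (hcz : 1 ≤ l₁ * Jz + l₂ * (2 * c₀) + l₃ * Kz) (hcy : 1 ≤ l₁ * Jy + l₂ * Jy₂ + l₃ * (2 * c₀))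
    (hV : l₁ + l₂ + l₃ ≤ V) : x + z + y ≤ V := by
  have hjpos : 0 < jr := lt_of_lt_of_le hj₀ hjr
  have hkpos : 0 < kr := lt_of_lt_of_le (mul_pos (by linarith) hjpos) hk1
  have hnpos : 0 < nr := lt_of_lt_of_le (mul_pos (by linarith) hkpos) hn1
  have hσ₁ : 0 < σ₁ := lt_of_lt_of_le hs₁ hσ₁l
  have hσ₂ : 0 < σ₂ := lt_of_lt_of_le hs₂ hσ₂l
  have hσ : 0 < σ₁ * σ₂ := mul_pos hσ₁ hσ₂
  -- spans of the three pairs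
  have hnj1 : F₁l * F₂l * jr ≤ nr :=
    calc F₁l * F₂l * jr = F₂l * (F₁l * jr) := by ring
      _ ≤ F₂l * kr := mul_le_mul_of_nonneg_left hk1 (by linarith)
      _ ≤ nr := hn1
  have hF2h : 0 ≤ F₂h := by
    by_contra hneg
    push Not at hneg
    have : F₂h * kr < 0 := mul_neg_of_neg_of_pos hneg hkpos
    linarith
  have hnj2 : nr ≤ F₁h * F₂h * jr :=
    calc nr ≤ F₂h * kr := hn2
      _ ≤ F₂h * (F₁h * jr) := mul_le_mul_of_nonneg_left hk2 hF2h
      _ = F₁h * F₂h * jr := by ring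
  -- the six corner inequalities
  have e1 : Jz ≤ 2 * c₁ * (jr / kr) * σ₁ ^ 2 := hJz.trans (oldJ_ge hjpos hkpos hk2 hs₁.le hσ₁l hc₁)
  have e2 : Jy ≤ 2 * c₂ * (jr / nr) * (σ₁ * σ₂) ^ 2 :=
    hJy.trans (oldJ_ge hjpos hnpos hnj2 (mul_pos hs₁ hs₂).le (mul_le_mul hσ₁l hσ₂l hs₂.le hσ₁.le) hc₂)
  have e3 : Kx₁ ≤ 2 * cT₁ * (τ₁ / jr) / σ₁ ^ 2 + 2 * ((kr - jr - τ₁) / jr + c₁) / σ₁ ^ 3 :=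
    hKx₁.trans (splitK_ge hjpos hk1 hτ₁l hτ₁h hθ₁lo hθ₁ hσ₁ hσ₁h hcT₁ hc₁)
  have e4 : Jy₂ ≤ 2 * c₃ * (kr / nr) * σ₂ ^ 2 := hJy₂.trans (oldJ_ge hkpos hnpos hn2 hs₂.le hσ₂l hc₃)
  have e5 : Kx₂ ≤ 2 * cT₂ * (τ₂ / jr) / (σ₁ * σ₂) ^ 2 + 2 * ((nr - jr - τ₂) / jr + c₂) / (σ₁ * σ₂) ^ 3 :=
    hKx₂.trans (splitK_ge hjpos hnj1 hτ₂l hτ₂h hθ₂lo hθ₂ hσ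
      (mul_le_mul hσ₁h hσ₂h hσ₂.le (le_trans hσ₁.le hσ₁h)) hcT₂ hc₂)
  have e6 : Kz ≤ 2 * cT₃ * (τ₃ / kr) / σ₂ ^ 2 + 2 * ((nr - kr - τ₃) / kr + c₃) / σ₂ ^ 3 :=
    hKz.trans (splitK_ge hkpos hn1 hτ₃l hτ₃h hθ₃lo hθ₃ hσ₂ hσ₂h hcT₃ hc₃)
  exact triple_cap_of_multipliers hx hz hy hWj hWk hWn le_rfl e1 e2 e3 le_rfl e4 e5 e6 le_rfl hl₁ hl₂ hl₃ hcx hcz hcy hV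

end Summit.QuantumFields.BalabanUV.Beta.EriceRemainderEnclosureHistoryAutonomyComparisonAgeCompositionTripleBox
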